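import Summits.SmoothPoincare4.SmoothPoincare4.Theorems.CylinderEntropyCylinderRungTwoCylKernelLipschitz
import Mathlib.MeasureTheory.Integral.Lebesgue.Map
import Mathlib.MeasureTheory.Integral.IntegrableOn
import HarnessLib

/-!
# Almost-isometric `C⁰`-small deformations do not raise the typed densities of `N = S⁴ × ℝ` at
# scales `τ ≥ τ₀` (registered helper `helper_cylDensity_image_le`)

Registered helper `helper_cylDensity_image_le` (wave 4, lead c7) of line `killing-flux` of the crux
`CylinderEntropy.CylinderRungTwo` (stmt-SmoothPoincare4-7631).  Everything here is proved (no named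
facts, no definitions); theorems only.

Let `N = {z ∈ ℝ⁶ | ∑_{i<5} zᵢ² = 1}`, `C = {∑_{i<5} zᵢ² ≤ 1} ⊇ N` the solid cylinder,
`K_{p,τ} = cylKernel p τ` the typed kernel and
`F̂_{p,τ}(A) = cylDensity A p τ = (μH⁴(S⁴))⁻¹ ∫_A K_{p,τ} dμH⁴` the typed density.  The port of the
Chodosh–Mantoulidis–Schulze generic-perturbation step to `N` replaces a cross-section `A ⊂ N` by
`Φ(A)` for a deformation `Φ` which is `(1+η)`-Lipschitz on `A`, moves points by `≤ η`, and lands in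
`C`.  **For every `τ₀ > 0` there is one constant `L` (the Lipschitz constant of the kernels on `C`
from `helper_cylKernel_lipschitzOn`) such that for all such `A, Φ, η`, all `p ∈ N`, `τ ≥ τ₀`:**

  `F̂_{p,τ}(Φ A) ≤ (1+η)⁴ · (F̂_{p,τ}(A) + L η · μH⁴(A)/μH⁴(S⁴))`.

*Proof.* (1) Domination of measures: for `Φ` `(1+η)`-Lipschitz on the measurable set `A`,
`μH⁴⌊Φ(A) ≤ (1+η)⁴ · Φ_* (μH⁴⌊A)` (on a measurable `S`, `Φ(A) ∩ S = Φ(A ∩ Φ⁻¹S)` has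
`μH⁴ ≤ (1+η)⁴ μH⁴(A ∩ Φ⁻¹ S)`, Federer 2.10.11 / Mathlib's
`LipschitzOnWith.hausdorffMeasure_image_le`; `Φ` is a.e.-measurable for `μH⁴⌊A` being continuous
on `A`), whence `∫_{Φ A} K ≤ (1+η)⁴ ∫_A K ∘ Φ` (`lintegral_map_le`).  (2) On `A` both `z ∈ N ⊆ C`
and `Φ z ∈ C`, so `K(Φ z) ≤ K(z) + L ‖Φ z - z‖ ≤ K(z) + L η`, and
`∫_A K ∘ Φ ≤ ∫_A K + L η μH⁴(A)`.  (3) Multiply by `(μH⁴(S⁴))⁻¹`.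

References: H. Federer, *Geometric Measure Theory* (1969), 2.10.11; O. Chodosh, C. Mantoulidis,
F. Schulze, *Mean curvature flow with generic low-entropy initial data II* (the perturbation step
being ported); the estimate itself is elementary measure theory.
-/

-- the prescribed namespace `Summit.SmoothPoincare4.SmoothPoincare4.…` repeats `SmoothPoincare4`
set_option linter.dupNamespace false

noncomputable section

open MeasureTheory Set Function Filter Module
open scoped ENNReal Topology NNReal BigOperators

namespace Summit.SmoothPoincare4.SmoothPoincare4.Theorems.CylinderRungTwo.KillingFlux

open Literature.Geometry.Riemannian
open Literature.Geometry.Riemannian.SphericalCylinderEntropy (cylKernel cylDensity)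

namespace CylDensityImageLe

/-! ## Lipschitz images: domination of the restricted Hausdorff measure -/

/-- **Domination of measures under a Lipschitz-on map**: if `Φ` is `K`-Lipschitz on the measurable
set `A`, then `μH[d]⌊(Φ '' A) ≤ K^d · Φ_* (μH[d]⌊A)` (on a measurable `S`,
`S ∩ Φ '' A = Φ '' (Φ⁻¹ S ∩ A)` and Federer 2.10.11; `Φ` is a.e.-measurable for `μH[d]⌊A`, being
continuous on `A`). [folklore] -/
theorem restrict_image_le_smul_map {X Y : Type*} [EMetricSpace X] [MeasurableSpace X] [BorelSpace X]
    [EMetricSpace Y] [MeasurableSpace Y] [BorelSpace Y] {K : ℝ≥0} {Φ : X → Y} {A : Set X}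
    (hA : MeasurableSet A) (hΦ : LipschitzOnWith K Φ A) {d : ℝ} (hd : 0 ≤ d) :
    (μH[d] : Measure Y).restrict (Φ '' A) ≤
      ((K : ℝ≥0∞) ^ d) • ((μH[d] : Measure X).restrict A).map Φ := by
  have hae : AEMeasurable Φ ((μH[d] : Measure X).restrict A) := hΦ.continuousOn.aemeasurable hA
  refine Measure.le_iff.2 fun S hS => ?_
  rw [Measure.restrict_apply hS, Measure.smul_apply, smul_eq_mul,
    Measure.map_apply_of_aemeasurable hae hS, Measure.restrict_apply' hA]
  calc (μH[d] : Measure Y) (S ∩ Φ '' A) = (μH[d] : Measure Y) (Φ '' (Φ ⁻¹' S ∩ A)) := by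
        rw [Set.image_preimage_inter]
    _ ≤ (K : ℝ≥0∞) ^ d * (μH[d] : Measure X) (Φ ⁻¹' S ∩ A) :=
        (hΦ.mono Set.inter_subset_right).hausdorffMeasure_image_le hd

/-- **Change of variables inequality for Lipschitz-on maps and Hausdorff measure**: if `Φ` is
`K`-Lipschitz on the measurable set `A`, then for every `f ≥ 0` (no measurability needed),
`∫⁻_{Φ '' A} f dμH[d] ≤ K^d · ∫⁻_A f ∘ Φ dμH[d]`. [folklore] -/
theorem setLIntegral_image_le_mul {X Y : Type*} [EMetricSpace X] [MeasurableSpace X] [BorelSpace X]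
    [EMetricSpace Y] [MeasurableSpace Y] [BorelSpace Y] {K : ℝ≥0} {Φ : X → Y} {A : Set X}
    (hA : MeasurableSet A) (hΦ : LipschitzOnWith K Φ A) {d : ℝ} (hd : 0 ≤ d) (f : Y → ℝ≥0∞) :
    ∫⁻ y in Φ '' A, f y ∂(μH[d] : Measure Y) ≤
      (K : ℝ≥0∞) ^ d * ∫⁻ x in A, f (Φ x) ∂(μH[d] : Measure X) := by
  calc ∫⁻ y in Φ '' A, f y ∂(μH[d] : Measure Y)
      ≤ ∫⁻ y, f y ∂(((K : ℝ≥0∞) ^ d) • ((μH[d] : Measure X).restrict A).map Φ) :=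
        lintegral_mono' (restrict_image_le_smul_map hA hΦ hd) le_rfl
    _ = (K : ℝ≥0∞) ^ d * ∫⁻ y, f y ∂(((μH[d] : Measure X).restrict A).map Φ) := by
        rw [lintegral_smul_measure, smul_eq_mul]
    _ ≤ (K : ℝ≥0∞) ^ d * ∫⁻ x in A, f (Φ x) ∂(μH[d] : Measure X) :=
        mul_le_mul' le_rfl (lintegral_map_le f Φ)

/-! ## The kernel moves by at most `L η` under an `η`-small displacement inside the solid cylinder -/

/-- If `k` is `L`-Lipschitz on `C`, `x, y ∈ C` and `‖x - y‖ ≤ η`, then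
`ofReal (k x) ≤ ofReal (k y) + ofReal (L η)` in `ℝ≥0∞`. [folklore] -/
theorem ofReal_le_ofReal_add_of_lipschitzOnWith {E : Type*} [NormedAddCommGroup E] {k : E → ℝ}
    {C : Set E} {L : ℝ≥0} (hk : LipschitzOnWith L k C) {x y : E} (hx : x ∈ C) (hy : y ∈ C)
    {η : ℝ} (hxy : ‖x - y‖ ≤ η) :
    ENNReal.ofReal (k x) ≤ ENNReal.ofReal (k y) + ENNReal.ofReal ((L : ℝ) * η) := by
  have h1 : k x ≤ k y + L * dist x y := hk.le_add_mul hx hy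
  rw [dist_eq_norm] at h1
  have h2 : k x ≤ k y + L * η := by
    have h3 : (L : ℝ) * ‖x - y‖ ≤ L * η := mul_le_mul_of_nonneg_left hxy L.coe_nonneg
    linarith
  exact (ENNReal.ofReal_le_ofReal h2).trans ENNReal.ofReal_add_le

end CylDensityImageLe

open CylDensityImageLe in
/-- **W4-1: almost-isometric `C⁰`-small deformations into the solid cylinder do not raise the typed
densities at scales `τ ≥ τ₀` by more than `(1+η)⁴` plus `L η · area / vol`.**  For `τ₀ > 0` there
is `L` (the uniform Lipschitz constant of `z ↦ K_{p,τ}(z)` on `{∑_{i<5} zᵢ² ≤ 1}` for `p ∈ N`,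
`τ ≥ τ₀`, `helper_cylKernel_lipschitzOn`) such that for every measurable `A ⊆ N`, every `Φ`
which is `(1+η)`-Lipschitz on `A` with `‖Φ z - z‖ ≤ η` and `Φ z` in the solid cylinder for
`z ∈ A`, every `p ∈ N` and `τ ≥ τ₀`:
`F̂_{p,τ}(Φ A) ≤ (1+η)⁴ (F̂_{p,τ}(A) + L η · (μH⁴(S⁴))⁻¹ μH⁴(A))` (domination
`μH⁴⌊Φ(A) ≤ (1+η)⁴ Φ_*(μH⁴⌊A)` from Federer 2.10.11, and `|K(Φ z) - K(z)| ≤ L η` on `A`).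
[folklore] -/
theorem helper_cylDensity_image_le : ∀ τ₀ : ℝ, 0 < τ₀ → ∃ L : NNReal, ∀ (A : Set (EuclideanSpace ℝ (Fin 6))), MeasurableSet A → (∀ z ∈ A, ∑ i : Fin 5, z (Fin.castSucc i) ^ 2 = 1) → ∀ (Φ : EuclideanSpace ℝ (Fin 6) → EuclideanSpace ℝ (Fin 6)) (η : NNReal), LipschitzOnWith (1 + η) Φ A → (∀ z ∈ A, ‖Φ z - z‖ ≤ η) → (∀ z ∈ A, ∑ i : Fin 5, Φ z (Fin.castSucc i) ^ 2 ≤ 1) → MeasurableSet (Φ '' A) → ∀ p : EuclideanSpace ℝ (Fin 6), ∑ i : Fin 5, p (Fin.castSucc i) ^ 2 = 1 → ∀ τ : ℝ, τ₀ ≤ τ → Literature.Geometry.Riemannian.SphericalCylinderEntropy.cylDensity (Φ '' A) p τ ≤ (1 + (η : ℝ≥0∞)) ^ 4 * (Literature.Geometry.Riemannian.SphericalCylinderEntropy.cylDensity A p τ + ENNReal.ofReal ((L : ℝ) * η) * ((μH[4] (Metric.sphere (0 : EuclideanSpace ℝ (Fin 5)) 1))⁻¹ * μH[4] A)) := by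
  intro τ₀ hτ₀
  obtain ⟨L, hL⟩ := helper_cylKernel_lipschitzOn τ₀ hτ₀
  refine ⟨L, fun A hA hAN Φ η hΦ hΦη hΦC _ p hp τ hτ => ?_⟩
  have hLip := hL p hp τ hτ
  -- (1) domination of measures and change of variables
  have h1 : ∫⁻ z in Φ '' A, ENNReal.ofReal (cylKernel p τ z) ∂μH[4] ≤
      (1 + (η : ℝ≥0∞)) ^ 4 * ∫⁻ z in A, ENNReal.ofReal (cylKernel p τ (Φ z)) ∂μH[4] := by
    have h := setLIntegral_image_le_mul hA hΦ (d := 4) (by norm_num)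
      (fun z => ENNReal.ofReal (cylKernel p τ z))
    rwa [ENNReal.rpow_ofNat, ENNReal.coe_add, ENNReal.coe_one] at h
  -- (2) the kernel moves by at most `L η`
  have h2 : ∫⁻ z in A, ENNReal.ofReal (cylKernel p τ (Φ z)) ∂μH[4] ≤
      (∫⁻ z in A, ENNReal.ofReal (cylKernel p τ z) ∂μH[4]) +
        ENNReal.ofReal ((L : ℝ) * η) * μH[4] A := by
    calc ∫⁻ z in A, ENNReal.ofReal (cylKernel p τ (Φ z)) ∂μH[4]
        ≤ ∫⁻ z in A, (ENNReal.ofReal (cylKernel p τ z) + ENNReal.ofReal ((L : ℝ) * η)) ∂μH[4] :=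
          setLIntegral_mono' hA fun z hz =>
            ofReal_le_ofReal_add_of_lipschitzOnWith hLip (hΦC z hz) (hAN z hz).le (hΦη z hz)
      _ = (∫⁻ z in A, ENNReal.ofReal (cylKernel p τ z) ∂μH[4]) +
            ENNReal.ofReal ((L : ℝ) * η) * μH[4] A := by
          rw [lintegral_add_right _ measurable_const, setLIntegral_const]
  -- (3) normalise
  rw [cylDensity, cylDensity]
  calc (μH[4] (Metric.sphere (0 : EuclideanSpace ℝ (Fin 5)) 1))⁻¹ *
        ∫⁻ z in Φ '' A, ENNReal.ofReal (cylKernel p τ z) ∂μH[4]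
      ≤ (μH[4] (Metric.sphere (0 : EuclideanSpace ℝ (Fin 5)) 1))⁻¹ *
          ((1 + (η : ℝ≥0∞)) ^ 4 * ((∫⁻ z in A, ENNReal.ofReal (cylKernel p τ z) ∂μH[4]) +
            ENNReal.ofReal ((L : ℝ) * η) * μH[4] A)) :=
        mul_le_mul' le_rfl (h1.trans (mul_le_mul' le_rfl h2))
    _ = (1 + (η : ℝ≥0∞)) ^ 4 *
          ((μH[4] (Metric.sphere (0 : EuclideanSpace ℝ (Fin 5)) 1))⁻¹ *
              (∫⁻ z in A, ENNReal.ofReal (cylKernel p τ z) ∂μH[4]) +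
            ENNReal.ofReal ((L : ℝ) * η) *
              ((μH[4] (Metric.sphere (0 : EuclideanSpace ℝ (Fin 5)) 1))⁻¹ * μH[4] A)) := by
        ring

end Summit.SmoothPoincare4.SmoothPoincare4.Theorems.CylinderRungTwo.KillingFlux

end
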